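import Summits.HodgeConjecture.HodgeConjecture.Theorems.K2LiuInertHeckeRecursion
import Literature.NumberTheory.Automorphic.HeckeOperatorAdjoint

/-!
# The Cartan volumes of `G_v = U(V)(L⁺_v)` at an INERT unramified place: `ν(K_v t₁ᵐ K_v) = (q_v+1)·q_v·(q_v²)^{m−1}·ν(K_v)`
# (LOCAL SEAM of s23, inert package, row 26 volumes — the `hvol` feed of #32dR's non-split datum)

Track B ∕ K2-LIT, hLiu418 = stmt-HodgeConjecture-24832; words `K2/K2Liu-p01/g3/INERT-SOCKETS-v2.K2Liup01g3.md` §0 («volumes»), plan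
`PLAN-28i-row26.K2Liup01g3.md` §4 (S2), consumer K2Liu-p04 (g3)'s #32dR closer ★ `K2LiuDoublingHeightDecayLocalR2OfNonsplitData` (`_hns`: per non-split
`v ∈ S` a rank-one Cartan datum `K₀, tv, C₁, Q` with `ν(K₀ tv_m K₀) ≤ C₁ Q^m`). Helper (count-neutral, own head per LEAD R3). For the K2Lit CURVE datum
`V = ⟨dV⟩` (`N = 2`), `v` INERT and UNRAMIFIED in `L`, a `σ_w`-fixed uniformizer `ϖ`, an integral hyperbolic frame `T` of the place form and a generator `t₁ ∈ G_v`
with `(t₁)_w = T⁻¹·diag(ϖ, ϖ⁻¹)·T`, and ANY left-invariant measure `ν` on `G_v`: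

* `measureReal_doubleCoset_pow_inert`: `ν(K_v t₁ᵐ K_v) = #(K_v t₁ᵐ K_v ∕ K_v)·ν(K_v)` with `# = 1, (q_v+1)q_v(q_v q_v)^{m−1}` (★ H3a `ncard_orbit_pow_inert`
  + ★ `measure_doubleCoset_eq_ncard_mul`);
* `measureReal_doubleCoset_pow_le_inert`: `ν(K_v t₁ᵐ K_v) ≤ ((q_v+1) q_v ν(K_v)) · (q_v²)^m`;
* **`exists_cartanVolumeDatum_inert`**: the packaged datum `K₀ = K_v` (compact open), `tv m = t₁ᵐ` (a ★ `IsCartanFamily`, ★ p857060, with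
  `(tv m)_w = T⁻¹·diag(ϖ^m, ϖ^{−m})·T` for ★ (D-n) `K2LiuNonsplitCartanDecayInert`), `Q = q_v²`, `C₁ = (q_v+1) q_v ν(K_v)`.
[BruhatTits1972, (4.4.3)]; [Macdonald1971, Ch. V §3 (3.5)]; [SerreTrees1980, II.1.1]. No `def`, no `sorry`. HONEST LABEL: HC_CM is proved only modulo
the printed citations (2 remaining named inputs: hLiu418 = stmt-HodgeConjecture-24832, h413 = stmt-HodgeConjecture-24833) until rung 0 closes;
this file is unconditional and moves no counter.
-/

set_option autoImplicit false

set_option linter.dupNamespace false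

noncomputable section

open scoped Matrix Pointwise
open NumberField IsDedekindDomain Matrix MeasureTheory MulAction

namespace Summit.HodgeConjecture.HodgeConjecture.Cruxes.HLiu418.K2LiuInertCartanVolumes

open Literature.NumberTheory.Automorphic Literature.NumberTheory.Automorphic.UnitaryGroup Literature.NumberTheory.GaloisRepresentations
open Literature.NumberTheory.GelbartRogawski1991 Literature.NumberTheory.GelbartRogawski1991.GRConstruction
open Literature.NumberTheory.K2Lit Literature.NumberTheory.K2Lit.SiegelDoubled
open Summit.HodgeConjecture.HodgeConjecture.Cruxes.HLiu418.K2LiuCartanFamilyInert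
open Summit.HodgeConjecture.HodgeConjecture.Cruxes.HLiu418.K2LiuInertHeckeRecursion

variable (L : Type) [Field L] [NumberField L] [IsCMField L]
variable (dV : Fin 2 → L) (v : HeightOneSpectrum (𝓞 (Fp L)))

set_option maxHeartbeats 400000 in -- measured 2026-09-04: default 200000 times out at `whnf` on the adelic unitary datum (`localPi`, `localInt`, quotient, orbits); 400000 passes
/-- **The Cartan volumes at an inert unramified place, exactly**: for a left-invariant measure `ν` on `G_v`,
`ν(K_v t₁ᵐ K_v) = #(K_v t₁ᵐ K_v ∕ K_v) · ν(K_v)` with `# = 1` (`m = 0`) and `= (q_v+1)·q_v·(q_v·q_v)^{m−1}` (`m ≥ 1`) (★ H3a `ncard_orbit_pow_inert`, ★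
`measure_doubleCoset_eq_ncard_mul`). [cite: Macdonald1971, Ch. V §3 (3.5)] [cite: SerreTrees1980, II.1.1] [cite: BruhatTits1972, (4.4.3)] -/
theorem measureReal_doubleCoset_pow_inert (w : UnitaryGroup.PlacesOver L v) (hw : IsCMField.complexConj L • w.1 = w.1)
    (hv : Algebra.IsUnramifiedIn (𝓞 L) v.asIdeal)
    {ϖ : w.1.adicCompletion L} (hϖ : Valued.v ϖ = WithZero.exp (-1 : ℤ))
    (hϖσ : galAdicCompletionMap (L := L) (IsCMField.complexConj L) hw ϖ = ϖ)
    (T : GL (Fin 2) (w.1.adicCompletion L)) (hTi : T ∈ glInt 2 (w.1.adicCompletion L))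
    (hTJ : UnitaryGroup.placeForm (Matrix.diagonal dV) w.1 =
      formCongr (galAdicCompletionMap (L := L) (IsCMField.complexConj L) hw) T ((StdForm.antidiagonal 2).over (w.1.adicCompletion L)))
    (t₁ : UnitaryGroup.localPi L (IsCMField.complexConj L) 2 (Matrix.diagonal dV) v)
    (ht₁ : Units.val ((t₁ : UnitaryGroup.LocalGLPi L 2 v) w) =
      ((T⁻¹ : GL (Fin 2) (w.1.adicCompletion L)) : Matrix (Fin 2) (Fin 2) (w.1.adicCompletion L)) *
        Matrix.diagonal ![ϖ, ϖ⁻¹] * (T : Matrix (Fin 2) (Fin 2) (w.1.adicCompletion L)))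
    [MeasurableSpace (UnitaryGroup.localPi L (IsCMField.complexConj L) 2 (Matrix.diagonal dV) v)]
    [BorelSpace (UnitaryGroup.localPi L (IsCMField.complexConj L) 2 (Matrix.diagonal dV) v)]
    (ν : Measure (UnitaryGroup.localPi L (IsCMField.complexConj L) 2 (Matrix.diagonal dV) v)) [ν.IsMulLeftInvariant] (m : ℕ) :
    (ν (DoubleCoset.doubleCoset (t₁ ^ m) (UnitaryGroup.localInt L (IsCMField.complexConj L) 2 (Matrix.diagonal dV) v : Set _)
        (UnitaryGroup.localInt L (IsCMField.complexConj L) 2 (Matrix.diagonal dV) v))).toReal =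
      ((if m = 0 then 1 else (v.residueCard + 1) * v.residueCard * (v.residueCard * v.residueCard) ^ (m - 1) : ℕ) : ℝ) *
        (ν (UnitaryGroup.localInt L (IsCMField.complexConj L) 2 (Matrix.diagonal dV) v : Set _)).toReal := by
  obtain ⟨hfin, hcard⟩ := ncard_orbit_pow_inert L dV v w hw hv hϖ hϖσ T hTi hTJ t₁ ht₁ m
  rw [measure_doubleCoset_eq_ncard_mul _ ν (UnitaryGroup.isOpen_localInt L (IsCMField.complexConj L) 2 (Matrix.diagonal dV) v) (t₁ ^ m) hfin, hcard,
    ENNReal.toReal_mul, ENNReal.toReal_natCast]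

set_option maxHeartbeats 400000 in -- measured 2026-09-04: default 200000 times out at `whnf` on the adelic unitary datum (`localPi`, `localInt`, quotient, orbits); 400000 passes
/-- **The Cartan volume bound**: `ν(K_v t₁ᵐ K_v) ≤ ((q_v+1)·q_v·ν(K_v)) · (q_v²)^m` for every `m` and every left-invariant `ν` finite on `K_v`.
[cite: Macdonald1971, Ch. V §3 (3.5)] [cite: SerreTrees1980, II.1.1] -/
theorem measureReal_doubleCoset_pow_le_inert (w : UnitaryGroup.PlacesOver L v) (hw : IsCMField.complexConj L • w.1 = w.1)
    (hv : Algebra.IsUnramifiedIn (𝓞 L) v.asIdeal)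
    {ϖ : w.1.adicCompletion L} (hϖ : Valued.v ϖ = WithZero.exp (-1 : ℤ))
    (hϖσ : galAdicCompletionMap (L := L) (IsCMField.complexConj L) hw ϖ = ϖ)
    (T : GL (Fin 2) (w.1.adicCompletion L)) (hTi : T ∈ glInt 2 (w.1.adicCompletion L))
    (hTJ : UnitaryGroup.placeForm (Matrix.diagonal dV) w.1 =
      formCongr (galAdicCompletionMap (L := L) (IsCMField.complexConj L) hw) T ((StdForm.antidiagonal 2).over (w.1.adicCompletion L)))
    (t₁ : UnitaryGroup.localPi L (IsCMField.complexConj L) 2 (Matrix.diagonal dV) v)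
    (ht₁ : Units.val ((t₁ : UnitaryGroup.LocalGLPi L 2 v) w) =
      ((T⁻¹ : GL (Fin 2) (w.1.adicCompletion L)) : Matrix (Fin 2) (Fin 2) (w.1.adicCompletion L)) *
        Matrix.diagonal ![ϖ, ϖ⁻¹] * (T : Matrix (Fin 2) (Fin 2) (w.1.adicCompletion L)))
    [MeasurableSpace (UnitaryGroup.localPi L (IsCMField.complexConj L) 2 (Matrix.diagonal dV) v)]
    [BorelSpace (UnitaryGroup.localPi L (IsCMField.complexConj L) 2 (Matrix.diagonal dV) v)]
    (ν : Measure (UnitaryGroup.localPi L (IsCMField.complexConj L) 2 (Matrix.diagonal dV) v)) [ν.IsMulLeftInvariant] (m : ℕ) :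
    (ν (DoubleCoset.doubleCoset (t₁ ^ m) (UnitaryGroup.localInt L (IsCMField.complexConj L) 2 (Matrix.diagonal dV) v : Set _)
        (UnitaryGroup.localInt L (IsCMField.complexConj L) 2 (Matrix.diagonal dV) v))).toReal ≤
      (((v.residueCard : ℝ) + 1) * v.residueCard * (ν (UnitaryGroup.localInt L (IsCMField.complexConj L) 2 (Matrix.diagonal dV) v : Set _)).toReal) *
        ((v.residueCard : ℝ) ^ 2) ^ m := by
  rw [measureReal_doubleCoset_pow_inert L dV v w hw hv hϖ hϖσ T hTi hTJ t₁ ht₁ ν m]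
  set q : ℕ := v.residueCard with hq
  have hK : 0 ≤ (ν (UnitaryGroup.localInt L (IsCMField.complexConj L) 2 (Matrix.diagonal dV) v : Set _)).toReal := ENNReal.toReal_nonneg
  have hcount : ((if m = 0 then 1 else (q + 1) * q * (q * q) ^ (m - 1) : ℕ) : ℝ) ≤ ((q : ℝ) + 1) * q * ((q : ℝ) ^ 2) ^ m := by
    have hq1 : 1 ≤ q := by
      rw [hq, HeightOneSpectrum.residueCard_eq_card_quotient]
      haveI : Finite (𝓞 (Fp L) ⧸ v.asIdeal) := Ideal.finiteQuotientOfFreeOfNeBot v.asIdeal v.ne_bot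
      exact Nat.one_le_iff_ne_zero.2 Finite.card_pos.ne'
    have hq1r : (1 : ℝ) ≤ q := by exact_mod_cast hq1
    split_ifs with hm0
    · subst hm0
      have h : (1 : ℝ) ≤ ((q : ℝ) + 1) * q := by nlinarith
      simpa using h
    · obtain ⟨k, rfl⟩ : ∃ k, m = k + 1 := ⟨m - 1, by omega⟩
      rw [Nat.add_sub_cancel]
      push_cast
      have hqq1 : (1 : ℝ) ≤ (q : ℝ) ^ 2 := by nlinarith
      have hpos : (0 : ℝ) ≤ ((q : ℝ) + 1) * q * ((q : ℝ) ^ 2) ^ k := by positivity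
      calc ((q : ℝ) + 1) * q * ((q : ℝ) * q) ^ k = ((q : ℝ) + 1) * q * ((q : ℝ) ^ 2) ^ k * 1 := by rw [sq, mul_one]
        _ ≤ ((q : ℝ) + 1) * q * ((q : ℝ) ^ 2) ^ k * (q : ℝ) ^ 2 := mul_le_mul_of_nonneg_left hqq1 hpos
        _ = ((q : ℝ) + 1) * q * ((q : ℝ) ^ 2) ^ (k + 1) := by rw [pow_succ ((q : ℝ) ^ 2) k]; ring
  calc ((if m = 0 then 1 else (q + 1) * q * (q * q) ^ (m - 1) : ℕ) : ℝ) *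
        (ν (UnitaryGroup.localInt L (IsCMField.complexConj L) 2 (Matrix.diagonal dV) v : Set _)).toReal
      ≤ ((q : ℝ) + 1) * q * ((q : ℝ) ^ 2) ^ m * (ν (UnitaryGroup.localInt L (IsCMField.complexConj L) 2 (Matrix.diagonal dV) v : Set _)).toReal :=
        mul_le_mul_of_nonneg_right hcount hK
    _ = _ := by ring

set_option maxHeartbeats 400000 in -- measured 2026-09-04: default 200000 times out at `whnf` on the adelic unitary datum (`localPi`, `localInt`, quotient, orbits); 400000 passes
/-- **THE RANK-ONE CARTAN VOLUME DATUM OF `G_v` AT AN INERT UNRAMIFIED PLACE, PACKAGED** for ★ `K2LiuDoublingHeightDecayLocalR2OfNonsplitData`'s `_hns`: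
`K₀ := K_v` (compact open), `tv m := t₁ᵐ` (a ★ `IsCartanFamily` for `K_v`, ★ p857060, with `(tv m)_w = T⁻¹·diag(ϖ^m, ϖ^{−m})·T` so that the decay ★ (D-n)
`K2LiuNonsplitCartanDecayInert` applies to the same family), `Q := q_v²`, `C₁ := (q_v+1)·q_v·ν(K_v)`: `ν(K₀ tv_m K₀) ≤ C₁ Q^m` for every `m`.
[cite: BruhatTits1972, (4.4.3)] [cite: Macdonald1971, Ch. V §3 (3.5)] [cite: SerreTrees1980, II.1.1] -/
theorem exists_cartanVolumeDatum_inert (w : UnitaryGroup.PlacesOver L v) (hw : IsCMField.complexConj L • w.1 = w.1)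
    (hv : Algebra.IsUnramifiedIn (𝓞 L) v.asIdeal)
    {ϖ : w.1.adicCompletion L} (hϖ : Valued.v ϖ = WithZero.exp (-1 : ℤ))
    (hϖσ : galAdicCompletionMap (L := L) (IsCMField.complexConj L) hw ϖ = ϖ)
    (T : GL (Fin 2) (w.1.adicCompletion L)) (hTi : T ∈ glInt 2 (w.1.adicCompletion L))
    (hTJ : UnitaryGroup.placeForm (Matrix.diagonal dV) w.1 =
      formCongr (galAdicCompletionMap (L := L) (IsCMField.complexConj L) hw) T ((StdForm.antidiagonal 2).over (w.1.adicCompletion L)))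
    (t₁ : UnitaryGroup.localPi L (IsCMField.complexConj L) 2 (Matrix.diagonal dV) v)
    (ht₁ : Units.val ((t₁ : UnitaryGroup.LocalGLPi L 2 v) w) =
      ((T⁻¹ : GL (Fin 2) (w.1.adicCompletion L)) : Matrix (Fin 2) (Fin 2) (w.1.adicCompletion L)) *
        Matrix.diagonal ![ϖ, ϖ⁻¹] * (T : Matrix (Fin 2) (Fin 2) (w.1.adicCompletion L)))
    [MeasurableSpace (UnitaryGroup.localPi L (IsCMField.complexConj L) 2 (Matrix.diagonal dV) v)]
    [BorelSpace (UnitaryGroup.localPi L (IsCMField.complexConj L) 2 (Matrix.diagonal dV) v)]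
    (ν : Measure (UnitaryGroup.localPi L (IsCMField.complexConj L) 2 (Matrix.diagonal dV) v)) [ν.IsMulLeftInvariant] :
    ∃ (K₀ : Subgroup (UnitaryGroup.localPi L (IsCMField.complexConj L) 2 (Matrix.diagonal dV) v))
      (tv : ℕ → UnitaryGroup.localPi L (IsCMField.complexConj L) 2 (Matrix.diagonal dV) v) (C₁ Q : ℝ),
      K₀ = UnitaryGroup.localInt L (IsCMField.complexConj L) 2 (Matrix.diagonal dV) v ∧ (∀ m, tv m = t₁ ^ m) ∧
      IsOpen (K₀ : Set (UnitaryGroup.localPi L (IsCMField.complexConj L) 2 (Matrix.diagonal dV) v)) ∧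
      IsCompact (K₀ : Set (UnitaryGroup.localPi L (IsCMField.complexConj L) 2 (Matrix.diagonal dV) v)) ∧
      IsCartanFamily K₀ tv ∧ Q = (v.residueCard : ℝ) ^ 2 ∧ 0 ≤ Q ∧ 0 ≤ C₁ ∧
      (∀ m, Units.val ((tv m : UnitaryGroup.LocalGLPi L 2 v) w) =
        ((T⁻¹ : GL (Fin 2) (w.1.adicCompletion L)) : Matrix (Fin 2) (Fin 2) (w.1.adicCompletion L)) *
          Matrix.diagonal ![ϖ ^ m, (ϖ ^ m)⁻¹] * (T : Matrix (Fin 2) (Fin 2) (w.1.adicCompletion L))) ∧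
      (∀ m, (ν (DoubleCoset.doubleCoset (tv m) (K₀ : Set _) K₀)).toReal ≤ C₁ * Q ^ m) := by
  let f : UnitaryGroup.localPi L (IsCMField.complexConj L) 2 (Matrix.diagonal dV) v →* GL (Fin 2) (w.1.adicCompletion L) :=
    { toFun := fun g => (g : UnitaryGroup.LocalGLPi L 2 v) w
      map_one' := rfl
      map_mul' := fun _ _ => rfl }
  have ht' : ∀ m : ℕ, Units.val ((t₁ ^ m : UnitaryGroup.LocalGLPi L 2 v) w) =
      ((T⁻¹ : GL (Fin 2) (w.1.adicCompletion L)) : Matrix (Fin 2) (Fin 2) (w.1.adicCompletion L)) *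
        Matrix.diagonal ![ϖ ^ m, (ϖ ^ m)⁻¹] * (T : Matrix (Fin 2) (Fin 2) (w.1.adicCompletion L)) := fun m =>
    coe_pow_of_coe_eq_conj_diagonal f T t₁ ht₁ m
  refine ⟨UnitaryGroup.localInt L (IsCMField.complexConj L) 2 (Matrix.diagonal dV) v, fun m => t₁ ^ m,
    ((v.residueCard : ℝ) + 1) * v.residueCard * (ν (UnitaryGroup.localInt L (IsCMField.complexConj L) 2 (Matrix.diagonal dV) v : Set _)).toReal,
    (v.residueCard : ℝ) ^ 2, rfl, fun m => rfl,
    UnitaryGroup.isOpen_localInt L (IsCMField.complexConj L) 2 (Matrix.diagonal dV) v,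
    UnitaryGroup.isCompact_localInt L (IsCMField.complexConj L) 2 (Matrix.diagonal dV) v,
    isCartanFamily_localInt_inert L dV v w hw hv hϖ hϖσ T hTi hTJ (fun m => t₁ ^ m) ht', rfl, by positivity,
    by positivity, ht', fun m => ?_⟩
  exact measureReal_doubleCoset_pow_le_inert L dV v w hw hv hϖ hϖσ T hTi hTJ t₁ ht₁ ν m

end Summit.HodgeConjecture.HodgeConjecture.Cruxes.HLiu418.K2LiuInertCartanVolumes

end
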